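import Summits.Parity.GeneralizedHardyLittlewood.Theorems.FordMaynardNoSieveConst0164NegWitness0164FamiliesLow

/-!
# Route `FordMaynardNoSieveConst0164`, crux `NegWitness0164` (stmt-Parity-19102), line `birth`,
# stub `stub_tweakNeg0164`: a rational lower bound for Ford–Maynard's `F₃(α)` (the `n = 2` piece of `f_{1,1}`)

Helper file toward the certificate stub (K. Ford, J. Maynard, *On the theory of prime producing sieves*,
arXiv:2407.14368, §8, proof of Theorem 2.7 (c): "`F₃(α) = α ∫ 1/(u₁u₂) = log(α/max(ν, α − 1/2) − 1)`").
For the binding family `f_{1,1}(1-α, α) = α(N₂ + N₃ + N₄)` (`…FamiliesLow`) the piece `α N₂` is, for data with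
`F₀⁽³⁾ = -1` at the small vectors of the support, Ford–Maynard's `F₃(α) = (α/2) ∫_{v ∈ Δ₂(α)} 𝟙[ν ≤ vᵢ < 1/2]/(v₀v₁)`.
Instead of the logarithm we prove the RATIONAL lower bound obtained from `v₀ v₁ ≤ α²/4` (AM–GM) and the length of
the window of `v₀`:

* `K3_lower_0164` — for `1/2 + ν ≤ α ≤ 1 - ν` (`ν = 41/250`):
  `∫_{v ∈ Δ₂(α)} 𝟙[ν ≤ vᵢ < 1/2]/(v₀v₁) ≥ (4/α²)(1 - α)` (window `v₀ ∈ (α - 1/2, 1/2)`);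
* `K3_lower_0164'` — for `1/2 ≤ α ≤ 1/2 + ν`: `≥ (4/α²)(α - 2ν)·𝟙[…]` in the form `≥ (4/α²)(α - 1/2)`
  (window `v₀ ∈ [ν, α - ν] ⊇ (1/2 - ν, α - ν)`… we use the sub-window `(ν, α - ν)` of length `α - 2ν ≥ α - 1/2`);
* `alphaN2_ge_0164` — hence `α N₂ ≥ 2(1 - α)/α` on `[1/2 + ν, 1 - ν]` for data with `F₀⁽³⁾ = -1` at small vectors
  (numerically `F₃(1 - ν) = log(1.488) = 0.397 ≥ 0.392 = 2ν/(1 - ν)`: the bound is tight where it matters).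

Def-free.  References: [FordMaynard2024PrimeSieves] arXiv:2407.14368, §8 (proof of Theorem 2.7 (c), F₃ and F₄).
-/

noncomputable section

open Finset MeasureTheory Set
open scoped Classical
open Literature.Combinatorics.Enumerative
open Literature.NumberTheory.Sieve Literature.NumberTheory.Sieve.FordMaynard

namespace Summit.Parity.GeneralizedHardyLittlewood.FordMaynardNoSieveConst0164NegWitness0164

/-- The kernel `𝟙[ν ≤ vᵢ < 1/2]/(v₀v₁)` of `F₃, F₄` is measurable. [folklore] -/
theorem measurable_K3_0164 : Measurable (fun v : Fin 2 → ℝ =>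
    if (∀ i, (41 / 250 : ℝ) ≤ v i) ∧ (∀ i, v i < 1 / 2) then 1 / (v 0 * v 1) else 0) := by
  refine Measurable.ite ?_ (measurable_const.div ((measurable_pi_apply 0).mul (measurable_pi_apply 1)))
    measurable_const
  have h : {v : Fin 2 → ℝ | (∀ i, (41 / 250 : ℝ) ≤ v i) ∧ ∀ i, v i < 1 / 2} =
      (⋂ i, {v | (41 / 250 : ℝ) ≤ v i}) ∩ ⋂ i, {v : Fin 2 → ℝ | v i < 1 / 2} := by
    ext v; simp
  rw [h]
  exact (MeasurableSet.iInter fun i => measurableSet_le measurable_const (measurable_pi_apply i)).inter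
    (MeasurableSet.iInter fun i => measurableSet_lt (measurable_pi_apply i) measurable_const)

/-- The kernel `𝟙[ν ≤ vᵢ < 1/2]/(v₀v₁)` is nonnegative and `≤ (250/41)²`. [folklore] -/
theorem K3_nonneg_le_0164 (v : Fin 2 → ℝ) :
    0 ≤ (if (∀ i, (41 / 250 : ℝ) ≤ v i) ∧ (∀ i, v i < 1 / 2) then 1 / (v 0 * v 1) else 0) ∧
      (if (∀ i, (41 / 250 : ℝ) ≤ v i) ∧ (∀ i, v i < 1 / 2) then 1 / (v 0 * v 1) else 0) ≤ (250 / 41) ^ 2 := by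
  split_ifs with h
  · have h0 := h.1 0
    have h1 := h.1 1
    refine ⟨by positivity, ?_⟩
    rw [div_le_iff₀ (by positivity)]
    nlinarith [mul_le_mul h0 h1 (by norm_num) (by linarith)]
  · exact ⟨le_rfl, by positivity⟩

/-- **AM–GM lower bound for `F₃`-type integrals, upper range.** For `1/2 + ν ≤ α ≤ 1 - ν`, `ν = 41/250`:
`∫_{v ∈ Δ₂(α)} 𝟙[ν ≤ vᵢ < 1/2]/(v₀v₁) dv ≥ (4/α²)(1 - α)`: on the window `v₀ ∈ (α - 1/2, 1/2)` (length `1 - α`) the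
constraints hold and `1/(v₀(α - v₀)) ≥ 4/α²`. [cite: FordMaynard2024PrimeSieves, §8 (F₃(α), case α ≥ 1/2 + ν)] -/
theorem K3_lower_0164 {α : ℝ} (hα : 1 / 2 + 41 / 250 ≤ α) (hα1 : α ≤ 1 - 41 / 250) :
    4 / α ^ 2 * (1 - α) ≤ sliceIntegral 2 α (fun v =>
      if (∀ i, (41 / 250 : ℝ) ≤ v i) ∧ (∀ i, v i < 1 / 2) then 1 / (v 0 * v 1) else 0) := by
  set K : (Fin 2 → ℝ) → ℝ := fun v =>
    if (∀ i, (41 / 250 : ℝ) ≤ v i) ∧ (∀ i, v i < 1 / 2) then 1 / (v 0 * v 1) else 0 with hK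
  have hαpos : 0 < α := by linarith
  rw [sliceIntegral_succ_eq]
  have hint : Integrable (sliceIntegrand 1 α K) :=
    integrable_sliceIntegrand 1 α measurable_K3_0164 (C := (250 / 41) ^ 2) (by positivity)
      (fun v _ _ => by rw [abs_of_nonneg (K3_nonneg_le_0164 v).1]; exact (K3_nonneg_le_0164 v).2)
  have hnn : ∀ u, 0 ≤ sliceIntegrand 1 α K u := fun u => by
    unfold sliceIntegrand
    split_ifs
    · exact (K3_nonneg_le_0164 _).1
    · exact le_rfl
  set S : Set (Fin 1 → ℝ) := Set.pi Set.univ fun _ => Ioo (α - 1 / 2) (1 / 2) with hS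
  have hSm : MeasurableSet S := MeasurableSet.univ_pi fun _ => measurableSet_Ioo
  have hvol : volume S = ENNReal.ofReal (1 - α) := by
    rw [hS, volume_pi_pi]
    simp only [Real.volume_Ioo, Finset.prod_const, Finset.card_univ, Fintype.card_fin, pow_one]
    congr 1; ring
  have hval : ∀ u ∈ S, 4 / α ^ 2 ≤ sliceIntegrand 1 α K u := by
    intro u hu
    rw [hS, Set.mem_univ_pi] at hu
    obtain ⟨h1, h2⟩ := hu 0
    unfold sliceIntegrand
    rw [Fin.sum_univ_one, if_pos ⟨fun i => by rw [Subsingleton.elim i 0]; linarith, by linarith⟩]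
    simp only [hK, snoc_fin_one_eq, Fin.forall_fin_two, Matrix.cons_val_zero, Matrix.cons_val_one]
    rw [if_pos ⟨⟨by linarith, by linarith⟩, ⟨h2, by linarith⟩⟩]
    rw [div_le_div_iff₀ (by positivity) (by nlinarith)]
    nlinarith [sq_nonneg (u 0 - (α - u 0))]
  calc 4 / α ^ 2 * (1 - α) = 4 / α ^ 2 * volume.real S := by
        simp only [Measure.real, hvol, ENNReal.toReal_ofReal (by linarith : (0 : ℝ) ≤ 1 - α)]
    _ ≤ ∫ u in S, sliceIntegrand 1 α K u :=
        setIntegral_ge_of_const_le_real hSm (by rw [hvol]; exact ENNReal.ofReal_ne_top) hval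
          hint.integrableOn
    _ ≤ ∫ u, sliceIntegrand 1 α K u :=
        setIntegral_le_integral hint (Filter.Eventually.of_forall hnn)

/-- **AM–GM lower bound for `F₃`-type integrals, lower range.** For `1/2 ≤ α ≤ 1/2 + ν`, `ν = 41/250`:
`∫_{v ∈ Δ₂(α)} 𝟙[ν ≤ vᵢ < 1/2]/(v₀v₁) dv ≥ (4/α²)(α - 2ν)` (window `v₀ ∈ (ν, α - ν)`).
[cite: FordMaynard2024PrimeSieves, §8 (F₃(α), case α < 1/2 + ν)] -/
theorem K3_lower_0164' {α : ℝ} (hα : 1 / 2 ≤ α) (hα1 : α ≤ 1 / 2 + 41 / 250) :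
    4 / α ^ 2 * (α - 2 * (41 / 250)) ≤ sliceIntegral 2 α (fun v =>
      if (∀ i, (41 / 250 : ℝ) ≤ v i) ∧ (∀ i, v i < 1 / 2) then 1 / (v 0 * v 1) else 0) := by
  set K : (Fin 2 → ℝ) → ℝ := fun v =>
    if (∀ i, (41 / 250 : ℝ) ≤ v i) ∧ (∀ i, v i < 1 / 2) then 1 / (v 0 * v 1) else 0 with hK
  have hαpos : 0 < α := by linarith
  rw [sliceIntegral_succ_eq]
  have hint : Integrable (sliceIntegrand 1 α K) :=
    integrable_sliceIntegrand 1 α measurable_K3_0164 (C := (250 / 41) ^ 2) (by positivity)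
      (fun v _ _ => by rw [abs_of_nonneg (K3_nonneg_le_0164 v).1]; exact (K3_nonneg_le_0164 v).2)
  have hnn : ∀ u, 0 ≤ sliceIntegrand 1 α K u := fun u => by
    unfold sliceIntegrand
    split_ifs
    · exact (K3_nonneg_le_0164 _).1
    · exact le_rfl
  set S : Set (Fin 1 → ℝ) := Set.pi Set.univ fun _ => Ioo (41 / 250 : ℝ) (α - 41 / 250) with hS
  have hSm : MeasurableSet S := MeasurableSet.univ_pi fun _ => measurableSet_Ioo
  have hvol : volume S = ENNReal.ofReal (α - 2 * (41 / 250)) := by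
    rw [hS, volume_pi_pi]
    simp only [Real.volume_Ioo, Finset.prod_const, Finset.card_univ, Fintype.card_fin, pow_one]
    congr 1; ring
  have hval : ∀ u ∈ S, 4 / α ^ 2 ≤ sliceIntegrand 1 α K u := by
    intro u hu
    rw [hS, Set.mem_univ_pi] at hu
    obtain ⟨h1, h2⟩ := hu 0
    unfold sliceIntegrand
    rw [Fin.sum_univ_one, if_pos ⟨fun i => by rw [Subsingleton.elim i 0]; linarith, by linarith⟩]
    simp only [hK, snoc_fin_one_eq, Fin.forall_fin_two, Matrix.cons_val_zero, Matrix.cons_val_one]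
    rw [if_pos ⟨⟨by linarith, by linarith⟩, ⟨by linarith, by linarith⟩⟩]
    rw [div_le_div_iff₀ (by positivity) (by nlinarith)]
    nlinarith [sq_nonneg (u 0 - (α - u 0))]
  calc 4 / α ^ 2 * (α - 2 * (41 / 250)) = 4 / α ^ 2 * volume.real S := by
        simp only [Measure.real, hvol, ENNReal.toReal_ofReal (by linarith : (0 : ℝ) ≤ α - 2 * (41 / 250))]
    _ ≤ ∫ u in S, sliceIntegrand 1 α K u :=
        setIntegral_ge_of_const_le_real hSm (by rw [hvol]; exact ENNReal.ofReal_ne_top) hval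
          hint.integrableOn
    _ ≤ ∫ u, sliceIntegrand 1 α K u :=
        setIntegral_le_integral hint (Filter.Eventually.of_forall hnn)

/-- `(v, b) ∈ ℝ³` for `v ∈ ℝ²`, `b ∈ ℝ¹`, as a vector literal. [folklore] -/
theorem append_two_one_eq (v : Fin 2 → ℝ) (b : Fin 1 → ℝ) : Fin.append v b = ![v 0, v 1, b 0] := by
  ext i
  fin_cases i
  · rfl
  · rfl
  · rfl

/-- **The `n = 2` piece of `f_{1,1}` is `F₃`**: for data with `F₀⁽³⁾ = -1` at the small vectors of the support,
`b = (1 - α)` with `ν ≤ 1 - α < 1/2`, the `n = 2` slice term equals `(1/2) ∫_{Δ₂(α)} 𝟙[ν ≤ vᵢ < 1/2]/(v₀v₁)`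
(`w₂ = -1/(2v₀v₁)` against `F₀⁽³⁾ = -1`; blocks with a piece `≥ 1/2` have weight `0`).
[cite: FordMaynard2024PrimeSieves, §8 ("f_{1,1}(1−α,α) ≥ F₃(α) + F₄(α)")] -/
theorem pieceTwo_family_one_eq_0164 {F₀ : VecFn}
    (h3eq : ∀ x : Fin 3 → ℝ, (∀ i, (41 / 250 : ℝ) ≤ x i) → (∀ i, x i < 1 / 2) → ∑ i, x i = 1 → F₀ 3 x = -1)
    (b : Fin 1 → ℝ) (hb : (41 / 250 : ℝ) ≤ b 0) (hb' : b 0 < 1 / 2) :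
    sliceIntegral 2 (1 - ∑ i, b i) (fun v => if ∀ t, (41 / 250 : ℝ) ≤ v t then
        blockWeight (1 / 2) 2 v * F₀ (2 + 1) (Fin.append v b) else 0) =
      1 / 2 * sliceIntegral 2 (1 - ∑ i, b i) (fun v =>
        if (∀ i, (41 / 250 : ℝ) ≤ v i) ∧ (∀ i, v i < 1 / 2) then 1 / (v 0 * v 1) else 0) := by
  rw [← sliceIntegral_const_mul]
  refine sliceIntegral_congr fun v hv hvs => ?_
  rw [Fin.sum_univ_one] at hvs
  rw [Fin.sum_univ_two] at hvs
  by_cases h1 : ∀ t, (41 / 250 : ℝ) ≤ v t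
  · rw [if_pos h1]
    by_cases h2 : ∀ i, v i < 1 / 2
    · rw [if_pos ⟨h1, h2⟩, blockWeight_two_eq v (by linarith [h2 0]) (by linarith [h2 1]) (by linarith),
        h3eq (Fin.append v b) ?_ ?_ ?_]
      · have := hv 0; have := hv 1
        field_simp
      · intro i
        have := h1 0; have := h1 1
        rw [append_two_one_eq]
        fin_cases i <;> simp <;> assumption
      · intro i
        have := h2 0; have := h2 1
        rw [append_two_one_eq]
        fin_cases i <;> simp <;> linarith
      · rw [append_two_one_eq, Fin.sum_univ_three]
        simp only [Matrix.cons_val_zero, Matrix.cons_val_one, Matrix.cons_val_two, Matrix.head_cons,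
          Matrix.tail_cons]
        linarith
    · rw [if_neg (fun h => h2 h.2), mul_zero]
      push Not at h2
      obtain ⟨i, hi⟩ := h2
      unfold blockWeight
      rw [linnikFn_eq_zero_of_mem (1 - 1 / 2) v (Finset.mem_univ i) (by linarith) fun k _ => (hv k).le,
        zero_div, zero_mul]
  · rw [if_neg h1, if_neg (fun h => h1 h.1), mul_zero]

/-- **`α N₂ ≥ 2(1 - α)/α` on `[1/2 + ν, 1 - ν]`** (rational substitute for `F₃(α) = log(α/(α - 1/2) - 1)`): for
data with `F₀⁽³⁾ = -1` at the small vectors of the support and `b = (1 - α)`, `ν ≤ 1 - α ≤ 1/2 - ν`.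
[cite: FordMaynard2024PrimeSieves, §8 (proof of Theorem 2.7 (c), F₃)] -/
theorem alphaN2_ge_0164 {F₀ : VecFn}
    (h3eq : ∀ x : Fin 3 → ℝ, (∀ i, (41 / 250 : ℝ) ≤ x i) → (∀ i, x i < 1 / 2) → ∑ i, x i = 1 → F₀ 3 x = -1)
    (b : Fin 1 → ℝ) (hb : (41 / 250 : ℝ) ≤ b 0) (hb' : b 0 ≤ 1 / 2 - 41 / 250) :
    2 * (∑ i, b i) / (1 - ∑ i, b i) ≤ (1 - ∑ i, b i) *
      sliceIntegral 2 (1 - ∑ i, b i) (fun v => if ∀ t, (41 / 250 : ℝ) ≤ v t then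
        blockWeight (1 / 2) 2 v * F₀ (2 + 1) (Fin.append v b) else 0) := by
  rw [pieceTwo_family_one_eq_0164 h3eq b hb (by linarith)]
  have hsum : ∑ i, b i = b 0 := Fin.sum_univ_one b
  have hK := K3_lower_0164 (α := 1 - ∑ i, b i) (by rw [hsum]; linarith) (by rw [hsum]; linarith)
  have hα : 0 < 1 - ∑ i, b i := by rw [hsum]; linarith
  rw [div_le_iff₀ hα]
  have : 4 / (1 - ∑ i, b i) ^ 2 * (1 - (1 - ∑ i, b i)) * (1 - ∑ i, b i) ^ 2 = 4 * ∑ i, b i := by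
    field_simp
    ring
  nlinarith [mul_le_mul_of_nonneg_left hK (by positivity : (0 : ℝ) ≤ (1 - ∑ i, b i) ^ 2)]

/-- **`α N₂ ≥ 2(α - 2ν)/α` on `[1/2, 1/2 + ν]`**, i.e. for `b = (1 - α)` with `1/2 - ν ≤ 1 - α ≤ 1/2`... in the
range `1/2 - ν ≤ b₀ < 1/2`. [cite: FordMaynard2024PrimeSieves, §8 (proof of Theorem 2.7 (c), F₃)] -/
theorem alphaN2_ge_0164' {F₀ : VecFn}
    (h3eq : ∀ x : Fin 3 → ℝ, (∀ i, (41 / 250 : ℝ) ≤ x i) → (∀ i, x i < 1 / 2) → ∑ i, x i = 1 → F₀ 3 x = -1)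
    (b : Fin 1 → ℝ) (hb : 1 / 2 - 41 / 250 ≤ b 0) (hb' : b 0 < 1 / 2) :
    2 * (1 - ∑ i, b i - 2 * (41 / 250)) / (1 - ∑ i, b i) ≤ (1 - ∑ i, b i) *
      sliceIntegral 2 (1 - ∑ i, b i) (fun v => if ∀ t, (41 / 250 : ℝ) ≤ v t then
        blockWeight (1 / 2) 2 v * F₀ (2 + 1) (Fin.append v b) else 0) := by
  rw [pieceTwo_family_one_eq_0164 h3eq b (by linarith) hb']
  have hsum : ∑ i, b i = b 0 := Fin.sum_univ_one b
  have hK := K3_lower_0164' (α := 1 - ∑ i, b i) (by rw [hsum]; linarith) (by rw [hsum]; linarith)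
  have hα : 0 < 1 - ∑ i, b i := by rw [hsum]; linarith
  rw [div_le_iff₀ hα]
  have : 4 / (1 - ∑ i, b i) ^ 2 * (1 - ∑ i, b i - 2 * (41 / 250)) * (1 - ∑ i, b i) ^ 2 =
      4 * (1 - ∑ i, b i - 2 * (41 / 250)) := by
    field_simp
  nlinarith [mul_le_mul_of_nonneg_left hK (by positivity : (0 : ℝ) ≤ (1 - ∑ i, b i) ^ 2)]

end Summit.Parity.GeneralizedHardyLittlewood.FordMaynardNoSieveConst0164NegWitness0164

end
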